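import Summits.QuantumFields.BalabanUV.T4Continuum.Support.RegionFaceFlux

/-!
# T⁴ programme, spine node NE2 (U1a), sub-row Δ1 «NE2⁰-Dirichlet» — THE TENT-vs-FACE COMPARISON, file 1 of 2: THE COLUMN LEMMA
# (one `ν`-column of the double block `B(y) ∪ B(y+e_ν)`, pure one-dimensional bookkeeping)

NE2 formalisation swarm `b2b-balaban-t4-ne2-formalise-*`, LEAF PROVER 06 (gen 5), supplier item «Δ1-VEC-W1-BOX-TENT» (row NE2 OWNER
`b2b-balaban-t4-ne2-p1` gen 14, O14-a «Δ1-VEC-W1-BOX» file 1 `Support/RegionFaceFlux` p232334, journal 2026-08-20 l.19654: «BOOKED OPEN —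
the TENT-vs-FACE comparison, for EVERY star-bond field `B`: `(n:ℝ)^d · nsq (avgR B − tentW • faceAvg B) ≤ C♭ · Σ_μ nsq (igrad μ B)`»).

THE MECHANISM (the owner's, l.19654; ours, no printed statement is used).  Fix a unit bond `(y,ν)` and a transverse offset `j` (`j_ν = 0`).
Along the `ν`-COLUMN of the double block `B(y) ∪ B(y+e_ν)` write `w(r)`, `0 ≤ r ≤ 2n−2`, for the zero-extended field on the bond at
height `r`.  Bałaban's line average contributes `Σ_{s<n} Σ_{t<n} w(s+t)` (the TENT `c(h) = #{s+t = h}`), the face flux contributes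
`w(n−1)`.  The bond at height `r` is a STAR bond iff `starH P Q n r := (r < n ∧ P) ∨ (n ≤ r+1 ∧ Q)` with `P = [y ∈ S]`, `Q = [y+e_ν ∈ S]`
(file 2, `star_col_iff`), so the star heights form an INTERVAL containing `n − 1` in each of the four membership cases
(all ∕ `r ≤ n−1` ∕ `r ≥ n−1` ∕ none), of tent mass `n²` resp. `n(n+1)/2 = λ_n·n²` (`λ_n = (n+1)/(2n)`, `RegionFaceFlux.lamB`) resp. `0`;
off the interval `w = 0`.  Hence `Σ_{s,t} w(s+t) − Λ·n²·w(n−1) = Σ_{s,t : s+t star} (w(s+t) − w(n−1))` EXACTLY, each difference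
telescopes through consecutive STAR heights, and
**`column_bound`**: `‖n·(Σ_{s,t<n} w(s+t) − Λ n²·w(n−1))‖ ≤ n²·Σ_{r<2n−2} dstep r`,
`dstep r = [r, r+1 star]·‖n·(w(r+1) − w(r))‖` (= the interior difference `‖igrad_ν B‖` of file 2), `Λ = lam P Q n ∈ {1, λ_n}`.

CONTENTS: §1 the star pattern `starH`, `lam`, `dstep`; §2 telescoping `norm_sub_le_sum_range(')`; §3 the tent identity-with-count
`tent_core` and the three counts `sum_sum_ite_lt` ∕ `sum_sum_ite_ge` ∕ (all); §4 **`column_bound`** (the four cases); §5 the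
`ν`-COLUMNS of a double block in the digit chart `x = n·y + j` ([B5] (1.6); tree `B5Block118.bpt`, `DirichletBoxTrace.bpt_update_add_tstep`):
`colPt y ν j r = n·y + j + r·e_ν`, the offsets `F0 = {j : j_ν = 0}`, `blockOf (colPt r) = y` (`r < n`) ∕ `y + e_ν` (`n ≤ r < 2n`), and
**`star_col_iff`**: for `r ≤ 2n − 2` the bond `(colPt r, ν)` is a star bond of `S` iff `starH [y ∈ S] [y+e_ν ∈ S] n r`.

HONEST FRAMING (T4-DAG p. 1).  [folklore] elementary finite sums; model-level vocabulary only; nothing printed is a hypothesis or a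
conclusion; W1 ∕ the box slice inequality NOT proved here; NE2 (U1a) NOT proved; spine PROVED 0/9 unchanged; NOT [B9] (3.16)/(3.23)–(3.27)
as printed; NOT infinite volume / mass gap / Clay.  HONEST DEPENDENCY: continuum YM on T⁴ ⇐ BetaPertH ∧ nine spine estimates (0/9 proved);
BetaPertH ⇐ (D1) ∧ (D4) ∧ CAP+tail; G-an2-4 gates asym, D1 and NE2/3/4.  No `sorry`, no `def … : Prop` fact (`starH` is a decidable
bookkeeping predicate on `ℕ`, not a named fact).
-/

noncomputable section

open scoped BigOperators
open Finset

namespace Summit.QuantumFields.BalabanUV.T4Continuum.RegionTentColumn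

open Literature.MathematicalPhysics.QuantumFieldTheory.Balaban1983to89.B5Prop11Plancherel (Tor fine unitVec)
open Literature.MathematicalPhysics.QuantumFieldTheory.Balaban1983to89.B5Block118 (bpt tstep tstep_succ bpt_add_tstep)
open Literature.MathematicalPhysics.QuantumFieldTheory.Balaban1983to89.B5Blocks16 (blockOf blockOf_bpt)
open Summit.QuantumFields.BalabanUV.T4Continuum
open Summit.QuantumFields.BalabanUV.T4Continuum.RegionGaugeFixedVector (starReg)
open Summit.QuantumFields.BalabanUV.T4Continuum.RegionStarLineGauge (tstep_add)
open Summit.QuantumFields.BalabanUV.Beta.GAN24.DirichletBoxTrace (blockReg bpt_update_add_tstep)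

/-! ## §1 The star pattern of a column, the tent weight, the star-restricted differences -/

/-- THE STAR PATTERN of the heights `r` of the `ν`-column over the unit bond `(y,ν)`: `(r < n ∧ P) ∨ (n ≤ r+1 ∧ Q)` with `P = [y ∈ S]`,
`Q = [y + e_ν ∈ S]` (file 2 `star_col_iff`: heights `≤ n−2` are star iff `P`, height `n−1` iff `P ∨ Q`, heights `n … 2n−2` iff `Q`). [folklore] -/
def starH (P Q : Prop) (n : ℕ) : ℕ → Prop := fun r => (r < n ∧ P) ∨ (n ≤ r + 1 ∧ Q)

/-- decidability of the star pattern. [folklore] -/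
instance decStarH (P Q : Prop) [Decidable P] [Decidable Q] (n r : ℕ) : Decidable (starH P Q n r) :=
  inferInstanceAs (Decidable ((r < n ∧ P) ∨ (n ≤ r + 1 ∧ Q)))

/-- THE TENT WEIGHT of the column: `1` if both blocks are in `S`, `λ_n = (n+1)/(2n)` otherwise (= `RegionFaceFlux.tentW` read at `(y,ν)`). [folklore] -/
def lam (P Q : Prop) [Decidable P] [Decidable Q] (n : ℕ) : ℝ := if P ∧ Q then 1 else ((n : ℝ) + 1) / (2 * n)

/-- THE STAR-RESTRICTED SCALED DIFFERENCE `[r, r+1 star]·‖n·(w(r+1) − w(r))‖` (= `‖igrad_ν B‖` at height `r`, file 2). [folklore] -/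
def dstep (P Q : Prop) [Decidable P] [Decidable Q] (n : ℕ) (w : ℕ → ℂ) (r : ℕ) : ℝ :=
  if starH P Q n r ∧ starH P Q n (r + 1) then ‖(n : ℂ) * (w (r + 1) - w r)‖ else 0

section

variable (P Q : Prop) [Decidable P] [Decidable Q] (n : ℕ) (w : ℕ → ℂ)

/-- `0 ≤ dstep`. [folklore] -/
theorem dstep_nonneg (r : ℕ) : 0 ≤ dstep P Q n w r := by
  unfold dstep; split_ifs <;> positivity

/-- `0 ≤ Σ dstep`. [folklore] -/
theorem sum_dstep_nonneg (K : ℕ) : 0 ≤ ∑ r ∈ range K, dstep P Q n w r :=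
  sum_nonneg fun r _ => dstep_nonneg P Q n w r

/-! ## §2 Telescoping through consecutive star heights -/

/-- telescoping along a chain of star heights: `‖c·(w(a+k) − w(a))‖ ≤ Σ_{a ≤ r < a+k} [r, r+1 star]‖c·(w(r+1) − w r)‖` when all heights
`a, …, a+k` are star. [folklore] -/
theorem norm_sub_le_sum_Ico (c : ℂ) (a : ℕ) :
    ∀ k, (∀ r, a ≤ r → r ≤ a + k → starH P Q n r) →
      ‖c * (w (a + k) - w a)‖
        ≤ ∑ r ∈ Ico a (a + k), (if starH P Q n r ∧ starH P Q n (r + 1) then ‖c * (w (r + 1) - w r)‖ else 0) := by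
  intro k
  induction k with
  | zero => intro _; simp
  | succ k ih =>
    intro hst
    have ih' := ih fun r h1 h2 => hst r h1 (by omega)
    have hk : starH P Q n (a + k) := hst (a + k) (by omega) (by omega)
    have hk1 : starH P Q n (a + k + 1) := hst (a + k + 1) (by omega) le_rfl
    rw [← add_assoc, Finset.sum_Ico_succ_top (by omega : a ≤ a + k), if_pos ⟨hk, hk1⟩]
    calc ‖c * (w (a + k + 1) - w a)‖ = ‖c * (w (a + k) - w a) + c * (w (a + k + 1) - w (a + k))‖ := by ring_nf
      _ ≤ ‖c * (w (a + k) - w a)‖ + ‖c * (w (a + k + 1) - w (a + k))‖ := norm_add_le _ _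
      _ ≤ _ := by gcongr

/-- the chain estimate against the whole column: for star heights `a ≤ … ≤ b ≤ K`, `‖n·(w b − w a)‖ ≤ Σ_{r<K} dstep r`. [folklore] -/
theorem norm_sub_le_sum_range {a b K : ℕ} (hab : a ≤ b) (hbK : b ≤ K) (hst : ∀ r, a ≤ r → r ≤ b → starH P Q n r) :
    ‖(n : ℂ) * (w b - w a)‖ ≤ ∑ r ∈ range K, dstep P Q n w r := by
  obtain ⟨k, rfl⟩ : ∃ k, b = a + k := ⟨b - a, by omega⟩
  refine (norm_sub_le_sum_Ico P Q n w (n : ℂ) a k hst).trans ?_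
  refine sum_le_sum_of_subset_of_nonneg ?_ fun r _ _ => dstep_nonneg P Q n w r
  intro r hr
  rw [mem_Ico] at hr
  rw [mem_range]
  omega

/-- the same estimate read downwards: `‖n·(w a − w b)‖ ≤ Σ_{r<K} dstep r`. [folklore] -/
theorem norm_sub_le_sum_range' {a b K : ℕ} (hab : a ≤ b) (hbK : b ≤ K) (hst : ∀ r, a ≤ r → r ≤ b → starH P Q n r) :
    ‖(n : ℂ) * (w a - w b)‖ ≤ ∑ r ∈ range K, dstep P Q n w r := by
  rw [← norm_neg, ← mul_neg, neg_sub]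
  exact norm_sub_le_sum_range P Q n w hab hbK hst

end

/-! ## §3 The tent sum against an interval of star heights, and the three counts -/

/-- **THE TENT IDENTITY-WITH-COUNT, normed**: if `w` vanishes off `I` (heights `< 2n − 1`) and `‖n·(w h − w(n−1))‖ ≤ Δ` on `I`, then
`‖n·(Σ_{s,t<n} w(s+t) − N_I·w(n−1))‖ ≤ n²·Δ` with the TENT MASS `N_I = #{(s,t) : s+t ∈ I}`. [folklore] -/
theorem tent_core (n : ℕ) (I : ℕ → Prop) [DecidablePred I] (w : ℕ → ℂ) {Δ : ℝ} (hΔ0 : 0 ≤ Δ)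
    (hw0 : ∀ h, h + 1 < 2 * n → ¬ I h → w h = 0)
    (hΔ : ∀ h, h + 1 < 2 * n → I h → ‖(n : ℂ) * (w h - w (n - 1))‖ ≤ Δ) :
    ‖(n : ℂ) * (∑ s ∈ range n, ∑ t ∈ range n, w (s + t)
        - (∑ s ∈ range n, ∑ t ∈ range n, (if I (s + t) then (1 : ℂ) else 0)) * w (n - 1))‖
      ≤ (n : ℝ) ^ 2 * Δ := by
  have key : ∀ s ∈ range n, ∀ t ∈ range n,
      (n : ℂ) * (w (s + t) - (if I (s + t) then (1 : ℂ) else 0) * w (n - 1))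
        = if I (s + t) then (n : ℂ) * (w (s + t) - w (n - 1)) else 0 := by
    intro s hs t ht
    rw [mem_range] at hs ht
    by_cases hI : I (s + t)
    · rw [if_pos hI, if_pos hI, one_mul]
    · rw [if_neg hI, if_neg hI, hw0 (s + t) (by omega) hI, zero_mul, sub_zero, mul_zero]
  have e1 : (n : ℂ) * (∑ s ∈ range n, ∑ t ∈ range n, w (s + t)
        - (∑ s ∈ range n, ∑ t ∈ range n, (if I (s + t) then (1 : ℂ) else 0)) * w (n - 1))
      = ∑ s ∈ range n, ∑ t ∈ range n, (if I (s + t) then (n : ℂ) * (w (s + t) - w (n - 1)) else 0) := by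
    rw [sum_mul, ← sum_sub_distrib, mul_sum]
    refine sum_congr rfl fun s hs => ?_
    rw [sum_mul, ← sum_sub_distrib, mul_sum]
    exact sum_congr rfl fun t ht => key s hs t ht
  rw [e1]
  calc ‖∑ s ∈ range n, ∑ t ∈ range n, (if I (s + t) then (n : ℂ) * (w (s + t) - w (n - 1)) else 0)‖
      ≤ ∑ s ∈ range n, ‖∑ t ∈ range n, (if I (s + t) then (n : ℂ) * (w (s + t) - w (n - 1)) else 0)‖ := norm_sum_le _ _
    _ ≤ ∑ s ∈ range n, ∑ t ∈ range n, ‖(if I (s + t) then (n : ℂ) * (w (s + t) - w (n - 1)) else 0)‖ :=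
        sum_le_sum fun s _ => norm_sum_le _ _
    _ ≤ ∑ s ∈ range n, ∑ t ∈ range n, Δ := by
        refine sum_le_sum fun s hs => sum_le_sum fun t ht => ?_
        rw [mem_range] at hs ht
        by_cases hI : I (s + t)
        · rw [if_pos hI]; exact hΔ (s + t) (by omega) hI
        · rw [if_neg hI, norm_zero]; exact hΔ0
    _ = (n : ℝ) ^ 2 * Δ := by rw [sum_const, sum_const, card_range, smul_smul, nsmul_eq_mul]; push_cast; ring

/-- `Σ_{s<n} (s + 1) = n(n+1)/2`. [folklore] -/
theorem sum_range_succ_cast (n : ℕ) : ∑ s ∈ range n, ((s : ℂ) + 1) = (n : ℂ) * (n + 1) / 2 := by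
  induction n with
  | zero => simp
  | succ n ih => rw [sum_range_succ, ih]; push_cast; ring

/-- THE LOWER HALF-TENT COUNT: `#{(s,t) ∈ [0,n)² : s + t < n} = n(n+1)/2`. [folklore] -/
theorem sum_sum_ite_lt (n : ℕ) :
    ∑ s ∈ range n, ∑ t ∈ range n, (if s + t < n then (1 : ℂ) else 0) = (n : ℂ) * (n + 1) / 2 := by
  have inner : ∀ s ∈ range n, ∑ t ∈ range n, (if s + t < n then (1 : ℂ) else 0) = ((n - 1 - s : ℕ) : ℂ) + 1 := by
    intro s hs
    rw [mem_range] at hs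
    rw [Finset.sum_boole]
    have hf : (range n).filter (fun t => s + t < n) = range (n - s) := by
      ext t; simp only [mem_filter, mem_range]; omega
    rw [hf, card_range]
    have : n - s = (n - 1 - s) + 1 := by omega
    rw [this]; push_cast; ring
  rw [sum_congr rfl inner, Finset.sum_range_reflect (fun s => (s : ℂ) + 1) n, sum_range_succ_cast]

/-- THE UPPER HALF-TENT COUNT: `#{(s,t) ∈ [0,n)² : n ≤ s + t + 1} = n(n+1)/2`. [folklore] -/
theorem sum_sum_ite_ge (n : ℕ) :
    ∑ s ∈ range n, ∑ t ∈ range n, (if n ≤ s + t + 1 then (1 : ℂ) else 0) = (n : ℂ) * (n + 1) / 2 := by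
  rw [← sum_sum_ite_lt n, ← Finset.sum_range_reflect _ n]
  refine sum_congr rfl fun s hs => ?_
  rw [← Finset.sum_range_reflect _ n]
  refine sum_congr rfl fun t ht => ?_
  rw [mem_range] at hs ht
  congr 1
  exact propext ⟨fun _ => by omega, fun _ => by omega⟩

/-- THE FULL TENT COUNT: `#[0,n)² = n²`. [folklore] -/
theorem sum_sum_one (n : ℕ) : ∑ _s ∈ range n, ∑ _t ∈ range n, (1 : ℂ) = (n : ℂ) ^ 2 := by
  rw [sum_const, sum_const, card_range, smul_smul, nsmul_eq_mul]; push_cast; ring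

/-! ## §4 The column bound -/

section

variable (P Q : Prop) [Decidable P] [Decidable Q] (n : ℕ) (w : ℕ → ℂ)

/-- **THE COLUMN BOUND** (all four membership cases of `(y, y + e_ν)` at once): if the column field `w` vanishes off the star heights,
`‖n·(Σ_{s<n}Σ_{t<n} w(s+t) − Λ·n²·w(n−1))‖ ≤ n²·Σ_{r<2n−2} dstep r`, `Λ = lam P Q n`. [folklore] -/
theorem column_bound (hn : 0 < n) (hw0 : ∀ r, r + 1 < 2 * n → ¬ starH P Q n r → w r = 0) :
    ‖(n : ℂ) * (∑ s ∈ range n, ∑ t ∈ range n, w (s + t) - ((lam P Q n * (n : ℝ) ^ 2 : ℝ) : ℂ) * w (n - 1))‖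
      ≤ (n : ℝ) ^ 2 * ∑ r ∈ range (2 * n - 2), dstep P Q n w r := by
  set Δ := ∑ r ∈ range (2 * n - 2), dstep P Q n w r with hΔdef
  have hΔ0 : 0 ≤ Δ := sum_dstep_nonneg P Q n w _
  have hnC : (n : ℂ) ≠ 0 := by exact_mod_cast hn.ne'
  by_cases hP : P
  · by_cases hQ : Q
    · -- all heights star: interval = everything, tent mass n², Λ = 1
      have hst : ∀ r, starH P Q n r := fun r => by
        unfold starH; by_cases h : r < n
        · exact Or.inl ⟨h, hP⟩
        · exact Or.inr ⟨by omega, hQ⟩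
      have hlam : ((lam P Q n * (n : ℝ) ^ 2 : ℝ) : ℂ) = ∑ s ∈ range n, ∑ t ∈ range n, (if True then (1 : ℂ) else 0) := by
        simp only [lam, if_pos (And.intro hP hQ), one_mul, if_true, sum_sum_one]; push_cast; ring
      rw [hlam]
      refine tent_core n (fun _ => True) w hΔ0 (fun h _ hI => absurd trivial hI) fun h hh _ => ?_
      rcases Nat.lt_or_ge (n - 1) h with hlt | hle
      · exact norm_sub_le_sum_range P Q n w hlt.le (by omega) fun r _ _ => hst r
      · exact norm_sub_le_sum_range' P Q n w hle (by omega) fun r _ _ => hst r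
    · -- star heights = [0, n): tent mass n(n+1)/2, Λ = λ_n
      have hst : ∀ r, starH P Q n r ↔ r < n := fun r => by
        unfold starH; exact ⟨fun h => h.elim (fun h => h.1) (fun h => absurd h.2 hQ), fun h => Or.inl ⟨h, hP⟩⟩
      have hlam : ((lam P Q n * (n : ℝ) ^ 2 : ℝ) : ℂ) = ∑ s ∈ range n, ∑ t ∈ range n, (if s + t < n then (1 : ℂ) else 0) := by
        rw [sum_sum_ite_lt, lam, if_neg (fun h => hQ h.2)]; push_cast; field_simp
      rw [hlam]
      refine tent_core n (fun h => h < n) w hΔ0 (fun h hh hI => hw0 h hh (by rw [hst]; exact hI)) fun h hh hI => ?_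
      exact norm_sub_le_sum_range' P Q n w (by omega) (by omega) fun r _ hr => (hst r).mpr (by omega)
  · by_cases hQ : Q
    · -- star heights = [n−1, 2n−2]: tent mass n(n+1)/2, Λ = λ_n
      have hst : ∀ r, starH P Q n r ↔ n ≤ r + 1 := fun r => by
        unfold starH; exact ⟨fun h => h.elim (fun h => absurd h.2 hP) (fun h => h.1), fun h => Or.inr ⟨h, hQ⟩⟩
      have hlam : ((lam P Q n * (n : ℝ) ^ 2 : ℝ) : ℂ) = ∑ s ∈ range n, ∑ t ∈ range n, (if n ≤ s + t + 1 then (1 : ℂ) else 0) := by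
        rw [sum_sum_ite_ge, lam, if_neg (fun h => hP h.1)]; push_cast; field_simp
      rw [hlam]
      refine tent_core n (fun h => n ≤ h + 1) w hΔ0 (fun h hh hI => hw0 h hh (by rw [hst]; exact hI)) fun h hh hI => ?_
      exact norm_sub_le_sum_range P Q n w (by omega) (by omega) fun r hr _ => (hst r).mpr (by omega)
    · -- no star height: the column field vanishes
      have hst : ∀ r, ¬ starH P Q n r := fun r h => by
        unfold starH at h; exact h.elim (fun h => hP h.2) (fun h => hQ h.2)
      have hz : ∀ r, r + 1 < 2 * n → w r = 0 := fun r hr => hw0 r hr (hst r)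
      have e1 : ∑ s ∈ range n, ∑ t ∈ range n, w (s + t) = 0 :=
        sum_eq_zero fun s hs => sum_eq_zero fun t ht => by
          rw [mem_range] at hs ht; exact hz (s + t) (by omega)
      rw [e1, hz (n - 1) (by omega), mul_zero, sub_zero, mul_zero, norm_zero]
      positivity

end

/-! ## §5 The `ν`-columns of a double block in the digit chart -/

section Columns

variable {d : ℕ} (n : ℕ) [NeZero n] (M : Fin d → ℕ) [hM : ∀ μ, NeZero (M μ)]

/-- the site at HEIGHT `r` of the `ν`-column of `B(y) ∪ B(y+e_ν) ∪ …` through the offset `j`: `n·y + j + r·e_ν`. [folklore] -/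
def colPt (y : Tor M) (ν : Fin d) (j : Fin d → Fin n) (r : ℕ) : Tor (fine n M) := bpt n M y j + tstep (fine n M) ν r

/-- the transverse offsets: `j` with `j_ν = 0`. [folklore] -/
def F0 (ν : Fin d) : Finset (Fin d → Fin n) := univ.filter (fun j : Fin d → Fin n => (j ν : ℕ) = 0)

omit hM in
/-- membership in `F0`. [folklore] -/
theorem mem_F0 {ν : Fin d} {j : Fin d → Fin n} : j ∈ F0 n ν ↔ (j ν : ℕ) = 0 := by
  simp [F0]

omit [NeZero n] hM in
/-- one step up the column. [folklore] -/
theorem colPt_succ (y : Tor M) (ν : Fin d) (j : Fin d → Fin n) (r : ℕ) :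
    colPt n M y ν j (r + 1) = colPt n M y ν j r + unitVec (fine n M) ν := by
  unfold colPt; rw [tstep_succ, add_assoc]

omit [NeZero n] hM in
/-- `n` steps up the column = the same column of the next block. [folklore] -/
theorem colPt_add (y : Tor M) (ν : Fin d) (j : Fin d → Fin n) (r : ℕ) :
    colPt n M y ν j (n + r) = colPt n M (y + unitVec M ν) ν j r := by
  unfold colPt; rw [tstep_add, ← add_assoc, bpt_add_tstep]

omit hM in
/-- for `j_ν = 0`, `Function.update j ν 0 = j`. [folklore] -/
theorem update_zero_eq {ν : Fin d} {j : Fin d → Fin n} (hj : (j ν : ℕ) = 0) : Function.update j ν 0 = j := by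
  have h0 : j ν = 0 := Fin.ext (by rw [hj, Fin.val_zero])
  rw [← h0, Function.update_eq_self]

omit hM in
/-- **the lower block in the chart**: for `j_ν = 0` and `s < n`, `colPt y ν j s = n·y + j[ν ↦ s]`. [folklore] -/
theorem colPt_eq_bpt_update (y : Tor M) {ν : Fin d} {j : Fin d → Fin n} (hj : (j ν : ℕ) = 0) (s : Fin n) :
    colPt n M y ν j (s : ℕ) = bpt n M y (Function.update j ν s) := by
  unfold colPt; rw [← bpt_update_add_tstep n M y j ν s, update_zero_eq n hj]

/-- heights `< n` lie in the block `y`. [folklore] -/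
theorem blockOf_colPt_of_lt (y : Tor M) {ν : Fin d} {j : Fin d → Fin n} (hj : (j ν : ℕ) = 0) {r : ℕ} (hr : r < n) :
    blockOf n M (colPt n M y ν j r) = y := by
  rw [show r = ((⟨r, hr⟩ : Fin n) : ℕ) from rfl, colPt_eq_bpt_update n M y hj, blockOf_bpt]

/-- heights `n ≤ r < 2n` lie in the block `y + e_ν`. [folklore] -/
theorem blockOf_colPt_of_ge (y : Tor M) {ν : Fin d} {j : Fin d → Fin n} (hj : (j ν : ℕ) = 0) {r : ℕ} (h1 : n ≤ r) (h2 : r < 2 * n) :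
    blockOf n M (colPt n M y ν j r) = y + unitVec M ν := by
  obtain ⟨r', rfl⟩ : ∃ r', r = n + r' := ⟨r - n, by omega⟩
  rw [colPt_add, blockOf_colPt_of_lt n M _ hj (by omega)]

section Region

variable (S : Tor M → Prop)

/-- **THE STAR PATTERN OF A COLUMN**: for `j_ν = 0` and `r ≤ 2n−2`, the bond at height `r` is a star bond iff
`starH [y ∈ S] [y + e_ν ∈ S] n r`. [folklore] -/
theorem star_col_iff (y : Tor M) {ν : Fin d} {j : Fin d → Fin n} (hj : (j ν : ℕ) = 0) {r : ℕ} (hr : r + 1 < 2 * n) :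
    starReg n M S (colPt n M y ν j r, ν) ↔ starH (S y) (S (y + unitVec M ν)) n r := by
  show S (blockOf n M (colPt n M y ν j r)) ∨ S (blockOf n M (colPt n M y ν j r + unitVec (fine n M) ν)) ↔ _
  rw [← colPt_succ]
  unfold starH
  by_cases h1 : r < n
  · rw [blockOf_colPt_of_lt n M y hj h1]
    by_cases h2 : r + 1 < n
    · rw [blockOf_colPt_of_lt n M y hj h2]
      have h3 : ¬ n ≤ r + 1 := by omega
      simp only [h1, true_and, h3, false_and, or_false, or_self]
    · rw [blockOf_colPt_of_ge n M y hj (by omega) hr]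
      have h3 : n ≤ r + 1 := by omega
      simp only [h1, true_and, h3]
  · rw [blockOf_colPt_of_ge n M y hj (by omega) (by omega), blockOf_colPt_of_ge n M y hj (by omega) hr]
    have h3 : n ≤ r + 1 := by omega
    simp only [h1, false_and, false_or, h3, true_and, or_self]

end Region

end Columns

end Summit.QuantumFields.BalabanUV.T4Continuum.RegionTentColumn

end
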